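import Literature.MathematicalPhysics.QuantumFieldTheory.Balaban1983to89.Node00.Record12BgRowMixed
import Literature.MathematicalPhysics.QuantumFieldTheory.Balaban1983to89.BlockAveragingEMLProp2
import Summits.QuantumFields.YangMills.Theorems.BalabanUVNodesK0VariationalThm1DatumCoupling
import Summits.QuantumFields.YangMills.Theorems.BalabanUVNodesN07SmallActionBoundaryAvoidance

/-!
# K0⁗ ROW P11 (negative side) — THE LEVEL-0 RANGE OF FILE 8 v1.2's `Sect2.outerPlaqs`: `outerPlaqs s.Ω k 0 = plaqInside Γ₀` on every sequence of record,
# so `VariationalThm1RegSepOuter → VariationalThm1RegSepMixed` UNCONDITIONALLY; and the C″ repair certificate: the Λ-range level-0 clause of print's (7)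
# charges the pinned corner plaquette that `outerPlaqs`∕`plaqInside` drop

Cell `pub-ymgap`, seat `pub-ymgap-dag-n21-c` g7 (R134 (a) N21 NE7c s1; HYP-AUDIT-13 witness, director-ym №142 (S2); INBOX INTENT-1 of 2026-08-27 ≈07:01Z).
Filed `--kind proof --supports stmt-QuantumFields-20289 --as helper` (K0⁗ `Record13SepInhabited`; typed negative∕bookkeeping knowledge about a SUPPLIER's
named fact, not a discharge).  [15] = [Balaban1985Variational]; [6] = [Balaban1985RegularSpaces]; [III] = [Balaban1988Convergent].

HONEST FRAMING.  node00-def-P11's FILE 8 v1.2 (`Node00/Record12BgRowMixed.lean` §6) re-typed print's data hypothesis (7) over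
`Sect2.outerPlaqs Ω k n := {p ∈ plaqsOf (genSet Ω k n) | NO CORNER of p in pts n (Ω (n+1))}` and keyed the named fact `VariationalThm1RegSepOuter` and the row's
body on it.  LOCATED (this file, kernel): at level `0`, on EVERY (2.18) index of record, `outerPlaqs s.Ω k 0` IS `plaqInside (genSet s.Ω k 0)` — for `k ≥ 1`
because `genSet … 0 = pts 0 (Ω 1)ᶜ = (Ω 1)ᶜ` (`pts 0` is the identity preimage), for `k = 0` because `Seq.Ω_off` empties both sides.  Hence def-P11's bridge
`VariationalThm1RegSepOuter.toMixed`, whose binder `h0` asks the inclusion for ARBITRARY `Ω` (false at `k = 0` in general), is dischargeable exactly where the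
fact quantifies: `variationalThm1RegSepMixed_of_outer : VariationalThm1RegSepOuter F N B₃ a₀ a₁ → VariationalThm1RegSepMixed F N B₃ a₀ a₁` with NO side
condition (§1).  CONSEQUENCE (with dag-n07-e g7's located (M3) «corner at level 0», INBOX l.17307, whose kernel certificate `¬ VariationalThm1RegSepMixed F 2 …`
is THEIR declaration INTENT-19 — not restated here): whatever refutes the §2 fact of FILE 8 refutes the §6 fact verbatim; `outerPlaqs` is NOT dag-ref-G's
print-exact cure «no BOND with both ends in Ω_{n+1}» (INBOX l.17312∕l.17323) — it drops, at every level, the plaquettes with exactly ONE corner in `Ω_{n+1}`,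
whose four bonds all meet `Γ_n` and are therefore PINNED by the fibre (`AgreeOn`, r12 `bondsOf` = «at least one endpoint», [6] (1.5) + p.77) while no clause
of `DataSmall7Outer` reads them.  §2 reads FILE 8 v1.3's CONCORD range BY NAME (`Sect2.plaqNoBondIn`, `Sect2.printedPlaqs`, `Sect2.DataSmall7P`, p507636): at level 0, on every index with
`k ≥ 1`, `printedPlaqs Ω k 0` is EXACTLY the set of plaquettes all of whose four bonds lie in `Λ₀ = bondsOf Γ₀` (`mem_printedPlaqs_zero_iff_bonds`), hence
EVERY level-0 printed plaquette is PINNED — `U₀(∂p) = W₀(∂p)` for every fibre element (`plaqHol_eq_of_agreeOn_of_mem_printedPlaqs_zero`): the v1.3 level-0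
clause constrains data-determined plaquettes only and all of them (print's first formula «(∂V)(p′) = V(∂p′)», [15] p.278 L26, no `V̄`).  Then the C″ REPAIR
CERTIFICATE at the corner plaquette of `…K0VariationalThm1ScaledCorner` (p498335) with dag-n07-e 19a's single-bond datum on the bond ENTERING `Ω₁` at the far corner (by name): the datum
passes `outerPlaqs`∕`plaqInside`'s level-0 clause for EVERY `δ₀ > 0` (all plaquettes inside `Γ₀` are trivial), its corner plaquette is pinned to `g`
(`dist1 g = t`) for every fibre element, and the printed-range clause `PlaqSmallOn (printedPlaqs s.Ω 1 0) δ₀` — hence `Sect2.DataSmall7P` for every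
completion of the datum at the higher scales — FAILS for every `δ₀ ≤ t`: the print-faithful predicate EXCLUDES the witness, exactly as `not_printed7_mixedDatum`
(p505245) did for (M2).  So the located defect of `VariationalThm1RegSepMixed`∕`…Outer` is of class refuted-MISSTATED with repair C″ = `VariationalThm1RegSepPrinted`
(FILE 8 v1.3 §7), which this witness does NOT touch.  Nothing of Bałaban is asserted or refuted; K0⁗ is neither discharged nor refuted here; counts unmoved;
no `def`, no `sorry`.

CONTENTS.
§1 `mem_outerPlaqs_iff`, `genSet_zero_of_pos`, `plaqInside_subset_outerPlaqs_zero_of_pos`, ★ `outerPlaqs_zero_eq_plaqInside_of_pos` (`k ≥ 1`; `⊆` is dag-n07-e 19a's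
   `outerPlaqs_zero_subset_plaqInside`, by name),
   `outerPlaqs_zero_eq_empty_of_empty` (`Ω 0 = ∅`, `k = 0`), ★ `outerPlaqs_zero_subset_plaqInside_seq` (every index of record), `dataSmall7Outer_of_dataSmall7_seq`,
   ★★ `variationalThm1RegSepMixed_of_outer`.
§2 `far_corner_mem_of_plaqsOf`, ★ `plaqHol_eq_of_agreeOn_of_bonds` (all four bonds in `bondsOf Γ₀` ⇒ `U₀(∂p) = W 0(∂p)` for every fibre element),
   `mem_bondsOf_genSet_zero_iff`, ★ `mem_plaqNoBondIn_zero_iff_bonds` ∕ ★ `mem_printedPlaqs_zero_iff_bonds` (FILE 8 v1.3's level-0 printed range = EXACTLY the plaquettes with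
   all four bonds in `Λ₀`), ★★ `plaqHol_eq_of_agreeOn_of_mem_printedPlaqs_zero` (every level-0 printed plaquette is pinned data), `plaqSmallOn_printedPlaqs_zero_iff_of_agreeOn`,
   ★★ `cornerDatum_outer_and_not_printed` (THE C″ CERTIFICATE on the one-cube index of p498335 with dag-n07-e 19a's single-bond datum BY NAME, every `N ≥ 2`, every
   `0 ≤ t ≤ 2`: passes `outerPlaqs`∕`plaqInside` at level 0 ∀δ₀ > 0, pinned corner `g⁻¹`, FAILS `printedPlaqs`∕`DataSmall7P` ∀δ₀ ≤ t).

DEPENDENCES (by name): FILE 8 v1.2∕v1.3 `Sect2.outerPlaqs`, `Sect2.DataSmall7(.toOuter)`, `Sect2.DataSmall7Outer`, `Sect2.plaqNoBondIn`, `Sect2.printedPlaqs`, `Sect2.DataSmall7P`,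
`VariationalThm1RegSepMixed`, `VariationalThm1RegSepOuter`;
r12 `B15DeterminingSets.(pts, pts_zero, genSet, gammaRegion_zero, gammaRegion_self, bondsOf, AgreeOn, avgFamily)`; r11 `B14.Eq218Concrete.Seq.Ω_off`; `B8Eq17ClassAkV1.plaqsOf`;
`Node00.plaqInside`; p498335 `exists_corner_plaq`, `exists_seq_singleCube`, `lt_sitesPerDir_zero`;
p505245 `exists_su_dist1_eq`; p476836 `BlockAveragingEMLProp2.shift_shift_comm`; dag-n07-e 19a p509187 `N07SmallActionBoundaryAvoidance.(outerPlaqs_zero_subset_plaqInside,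
cornerPlaq_bonds_mem_bondsOf, plaqHol_single_eq_one_of_plaqInside_compl, plaqHol_single_corner)`.
-/

noncomputable section

open scoped Matrix.Norms.L2Operator

namespace Summit.QuantumFields.YangMills.Theorems.K0VariationalThm1OuterRange

open Literature.MathematicalPhysics.QuantumFieldTheory.Balaban1983to89
open Literature.MathematicalPhysics.QuantumFieldTheory.Balaban1983to89.Node00
open Literature.MathematicalPhysics.QuantumFieldTheory.Balaban1983to89.T4Continuum
open B15DeterminingSets
open Summit.QuantumFields.YangMills.Theorems.K0VariationalThm1ScaledCorner (exists_corner_plaq exists_seq_singleCube lt_sitesPerDir_zero)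
open Summit.QuantumFields.YangMills.Theorems.K0VariationalThm1DatumCoupling (exists_su_dist1_eq)
open Literature.MathematicalPhysics.QuantumFieldTheory.Balaban1983to89.BlockAveragingEMLProp2 (shift_shift_comm)
open Summit.QuantumFields.YangMills.BalabanUVNodes.N07SmallActionBoundaryAvoidance (outerPlaqs_zero_subset_plaqInside cornerPlaq_bonds_mem_bondsOf
  plaqHol_single_eq_one_of_plaqInside_compl plaqHol_single_corner)

/-! ## §1  `outerPlaqs Ω k 0 = plaqInside Γ₀` on every index of record; `…Outer → …Mixed` unconditionally -/
section LevelZero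

variable {P : Params}

/-- Membership in FILE 8 v1.2's outer plaquette set (definitional). [cite: Balaban1985Variational, (7) p.278 (bookkeeping)] -/
theorem mem_outerPlaqs_iff (Ω : ℕ → Set (Site P 0)) (k n : ℕ) (p : Plaq P n) :
    p ∈ Sect2.outerPlaqs Ω k n ↔ p ∈ B8Eq17ClassAkV1.plaqsOf (genSet Ω k n) ∧ p.src ∉ pts n (Ω (n + 1)) ∧ p.src.shift p.μ ∉ pts n (Ω (n + 1)) ∧
      p.src.shift p.ν ∉ pts n (Ω (n + 1)) ∧ (p.src.shift p.μ).shift p.ν ∉ pts n (Ω (n + 1)) :=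
  Iff.rfl

/-- For `k ≥ 1` the scale-0 member of the determining set is `Γ₀ = (Ω₁)ᶜ` itself (`pts 0` is the identity). [cite: Balaban1988Convergent, (2.2) p.255 (bookkeeping)] -/
theorem genSet_zero_of_pos (Ω : ℕ → Set (Site P 0)) {k : ℕ} (hk : 0 < k) : genSet Ω k 0 = (Ω 1)ᶜ := by
  show pts 0 (gammaRegion Ω k 0) = _
  rw [gammaRegion_zero Ω hk, pts_zero]

/-- **`plaqInside Γ₀ ⊆ outerPlaqs Ω k 0` for `k ≥ 1`**: a plaquette with all four corners in `Γ₀` touches `Γ₀` and has no corner in `Ω₁`.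
[cite: Balaban1985Variational, (7) p.278 L23–26 (bookkeeping)] -/
theorem plaqInside_subset_outerPlaqs_zero_of_pos (Ω : ℕ → Set (Site P 0)) {k : ℕ} (hk : 0 < k) :
    plaqInside (genSet Ω k 0) ⊆ Sect2.outerPlaqs Ω k 0 := by
  intro p hp
  have hp' := hp
  rw [genSet_zero_of_pos Ω hk, mem_plaqInside_iff] at hp'
  obtain ⟨h1, h2, h3, h4⟩ := hp'
  rw [mem_outerPlaqs_iff]
  simp only [Nat.zero_add, pts_zero]
  exact ⟨Or.inl hp.1, h1, h2, h3, h4⟩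

/-- **★ `outerPlaqs Ω k 0 = plaqInside Γ₀` for `k ≥ 1`**: at level 0 FILE 8 v1.2's «no corner in Ω₁» range IS FILE 8 v1.0's «all four corners in Γ₀» range — both
drop the plaquettes with exactly one corner in `Ω₁` (`⊆`: dag-n07-e 19a `outerPlaqs_zero_subset_plaqInside`, by name). [cite: Balaban1985Variational, (7) p.278 L23–26 (bookkeeping)] -/
theorem outerPlaqs_zero_eq_plaqInside_of_pos (Ω : ℕ → Set (Site P 0)) {k : ℕ} (hk : 0 < k) :
    Sect2.outerPlaqs Ω k 0 = plaqInside (genSet Ω k 0) :=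
  Set.Subset.antisymm (outerPlaqs_zero_subset_plaqInside Ω hk) (plaqInside_subset_outerPlaqs_zero_of_pos Ω hk)

/-- At length `k = 0` with `Ω 0 = ∅` (r11's normalisation `Seq.Ω_off`) the level-0 outer set is EMPTY (nothing touches `pts 0 ∅`).
[cite: Balaban1988Convergent, (2.18) p.257 (bookkeeping)] -/
theorem outerPlaqs_zero_eq_empty_of_empty (Ω : ℕ → Set (Site P 0)) (hΩ : Ω 0 = ∅) : Sect2.outerPlaqs Ω 0 0 = ∅ := by
  ext p
  simp only [Set.mem_empty_iff_false, iff_false]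
  intro hp
  rw [mem_outerPlaqs_iff] at hp
  have h1 := hp.1
  have hg : genSet Ω 0 0 = (∅ : Set (Site P 0)) := by
    show pts 0 (gammaRegion Ω 0 0) = _
    rw [gammaRegion_self, pts_zero, hΩ]
  rw [hg, B8Eq17ClassAkV1.mem_plaqsOf] at h1
  simp at h1

variable (F : T4Family)

/-- **★ ON EVERY (2.18) INDEX OF RECORD, `outerPlaqs s.Ω k 0 ⊆ plaqInside (genSet s.Ω k 0)`** — the binder `h0` of node00-def-P11's `VariationalThm1RegSepOuter.toMixed`,
DISCHARGED where the facts quantify (`k ≥ 1`: equality above; `k = 0`: `s.Ω 0 = ∅` by `Seq.Ω_off`, the outer set is empty).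
[cite: Balaban1988Convergent, (2.2) p.255, (2.18) p.257 (bookkeeping)] -/
theorem outerPlaqs_zero_subset_plaqInside_seq {ν : Stage7Numerics} {M : ℕ} {g : ℕ → ℝ} {K k : ℕ} (s : SeqOfRecord F ν M g K k) :
    Sect2.outerPlaqs s.Ω k 0 ⊆ plaqInside (genSet s.Ω k 0) := by
  rcases Nat.eq_zero_or_pos k with rfl | hk
  · rw [outerPlaqs_zero_eq_empty_of_empty s.Ω (s.Ω_off 0 (by omega))]
    exact Set.empty_subset _
  · exact outerPlaqs_zero_subset_plaqInside s.Ω hk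

variable {F}

/-- On an index of record, FILE 8 v1.0's data predicate implies v1.2's (no side condition). [cite: Balaban1985Variational, (7) p.278 (bookkeeping)] -/
theorem dataSmall7Outer_of_dataSmall7_seq {G : Type*} [GaugeGroup G] {ν : Stage7Numerics} {M : ℕ} {g : ℕ → ℝ} {K k : ℕ} (s : SeqOfRecord F ν M g K k)
    {av : ∀ j, Averaging (F.P K) j G} {δ : ℕ → ℝ} {W : MSField (F.P K) G} (h : Sect2.DataSmall7 av s.Ω k δ W) : Sect2.DataSmall7Outer av s.Ω k δ W :=
  h.toOuter (outerPlaqs_zero_subset_plaqInside_seq F s)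

variable {N : ℕ} [NeZero N]

/-- **★★ `VariationalThm1RegSepOuter → VariationalThm1RegSepMixed`, UNCONDITIONALLY** (node00-def-P11's `.toMixed` with its binder `h0` discharged on the record's
sequences): whatever refutes FILE 8 §2's fact refutes §6's fact verbatim — in particular dag-n07-e g7's located (M3) «corner at level 0».
[cite: Balaban1985Variational, Thm 1 (7)–(8) pp.278–279 (bookkeeping)] -/
theorem variationalThm1RegSepMixed_of_outer {B₃ a₀ a₁ : ℝ} (h : VariationalThm1RegSepOuter F N B₃ a₀ a₁) : VariationalThm1RegSepMixed F N B₃ a₀ a₁ :=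
  fun ν M g K k s hsep ε₀ δ hδ hcomp hε₀ W h7 => h ν M g K k s hsep ε₀ δ hδ hcomp hε₀ W (dataSmall7Outer_of_dataSmall7_seq s h7)

/-- Contrapositive bookkeeping: a refutation of the §2 fact is a refutation of the §6 fact. [cite: Balaban1985Variational, Thm 1 (7)–(8) pp.278–279 (bookkeeping)] -/
theorem not_variationalThm1RegSepOuter_of_not_mixed {B₃ a₀ a₁ : ℝ} (h : ¬ VariationalThm1RegSepMixed F N B₃ a₀ a₁) :
    ¬ VariationalThm1RegSepOuter F N B₃ a₀ a₁ :=
  fun h' => h (variationalThm1RegSepMixed_of_outer h')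

end LevelZero

/-! ## §2  The C″ certificate: FILE 8 v1.3's printed range at level 0 = the pinned plaquettes; it charges the corner plaquette that `outerPlaqs`∕`plaqInside` drop -/
section LambdaRange

variable {P : Params}

/-- A plaquette that touches `X` while its source and its two near corners lie outside has its FAR corner in `X`. [cite: Balaban1985RegularSpaces, p.77 (bookkeeping)] -/
theorem far_corner_mem_of_plaqsOf {j : ℕ} {X : Set (Site P j)} {p : Plaq P j} (hp : p ∈ B8Eq17ClassAkV1.plaqsOf X) (h1 : p.src ∉ X)
    (h2 : p.src.shift p.μ ∉ X) (h3 : p.src.shift p.ν ∉ X) : (p.src.shift p.μ).shift p.ν ∈ X := by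
  rw [B8Eq17ClassAkV1.mem_plaqsOf] at hp
  rcases hp with h | h | h | h
  · exact absurd h h1
  · exact absurd h h2
  · exact absurd h h3
  · exact h

/-- **★ THE Λ-RANGE AT LEVEL 0 IS THE SET OF DATA-DETERMINED PLAQUETTES**: if all four bonds of a fine plaquette `p` belong to `Λ₀` (r12 `bondsOf (genSet Ω k 0)`,
«at least one endpoint in `Γ₀`»), then for every `U₀` in the fibre of `W` (`M_𝐁(U₀) = W` on `𝐁 = genSet Ω k`; `M⁰ = id`) the plaquette variable IS the datum's:
`U₀(∂p) = W₀(∂p)` — print's first formula «(∂V)(p′) = V(∂p′)» ([15] p.278 L26) applies with no `V̄`.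
[cite: Balaban1985Variational, (7) p.278 L23–28; Balaban1988Convergent, (2.10)–(2.12) p.256 (bookkeeping)] -/
theorem plaqHol_eq_of_agreeOn_of_bonds {G : Type*} [GaugeGroup G] (av : ∀ j, Averaging P j G) {Ω : ℕ → Set (Site P 0)} {k : ℕ} {W : MSField P G}
    {U₀ : GaugeField P 0 G} (h : AgreeOn (genSet Ω k) (avgFamily av U₀) W) (p : Plaq P 0)
    (hb1 : (⟨p.src, p.μ⟩ : PBond P 0) ∈ bondsOf (genSet Ω k 0)) (hb2 : (⟨p.src.shift p.μ, p.ν⟩ : PBond P 0) ∈ bondsOf (genSet Ω k 0))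
    (hb3 : (⟨p.src.shift p.ν, p.μ⟩ : PBond P 0) ∈ bondsOf (genSet Ω k 0)) (hb4 : (⟨p.src, p.ν⟩ : PBond P 0) ∈ bondsOf (genSet Ω k 0)) :
    GaugeField.plaqHol U₀ p = GaugeField.plaqHol (W 0) p := by
  have hb : ∀ b : PBond P 0, b ∈ bondsOf (genSet Ω k 0) → U₀ b = W 0 b := fun b hb => h 0 b hb
  simp only [GaugeField.plaqHol]
  rw [hb _ hb1, hb _ hb2, hb _ hb3, hb _ hb4]

/-- **Λ-range ⟺ «no bond inside Ω₁» at level 0** (`k ≥ 1`): a fine bond belongs to `Λ₀ = bondsOf Γ₀` iff NOT both of its endpoints lie in `Ω₁` — so «all four bonds in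
`bondsOf Γ₀`» (dag-n07-e (r1′)) is dag-ref-G's «no bond with both ends in `pts 0 (Ω 1)`» (INBOX l.17312). [cite: Balaban1985RegularSpaces, (1.5) p.77 (bookkeeping)] -/
theorem mem_bondsOf_genSet_zero_iff (Ω : ℕ → Set (Site P 0)) {k : ℕ} (hk : 0 < k) (b : PBond P 0) :
    b ∈ bondsOf (genSet Ω k 0) ↔ ¬ (b.src ∈ pts 0 (Ω 1) ∧ b.tgt ∈ pts 0 (Ω 1)) := by
  rw [genSet_zero_of_pos Ω hk]
  simp only [bondsOf, Set.mem_setOf_eq, Set.mem_compl_iff, pts_zero]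
  tauto

/-- Membership in FILE 8 v1.3's «no bond inside `Ω_{n+1}`» set (definitional). [cite: Balaban1985Variational, (7) p.278 (bookkeeping)] -/
theorem mem_plaqNoBondIn_iff (Ω : ℕ → Set (Site P 0)) (n : ℕ) (p : Plaq P n) :
    p ∈ Sect2.plaqNoBondIn Ω n ↔
      ¬ (p.src ∈ pts n (Ω (n + 1)) ∧ p.src.shift p.μ ∈ pts n (Ω (n + 1))) ∧
      ¬ (p.src.shift p.μ ∈ pts n (Ω (n + 1)) ∧ (p.src.shift p.μ).shift p.ν ∈ pts n (Ω (n + 1))) ∧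
      ¬ (p.src.shift p.ν ∈ pts n (Ω (n + 1)) ∧ (p.src.shift p.μ).shift p.ν ∈ pts n (Ω (n + 1))) ∧
      ¬ (p.src ∈ pts n (Ω (n + 1)) ∧ p.src.shift p.ν ∈ pts n (Ω (n + 1))) :=
  Iff.rfl

/-- **★ AT LEVEL 0, «NO BOND INSIDE Ω₁» ⟺ «ALL FOUR BONDS IN Λ₀ = bondsOf Γ₀»** (`k ≥ 1`): FILE 8 v1.3's `plaqNoBondIn Ω 0` is dag-n07-e's (r1′) range verbatim.
[cite: Balaban1985Variational, (7) p.278 L23–28; Balaban1985RegularSpaces, (1.5) p.77 (bookkeeping)] -/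
theorem mem_plaqNoBondIn_zero_iff_bonds (Ω : ℕ → Set (Site P 0)) {k : ℕ} (hk : 0 < k) (p : Plaq P 0) :
    p ∈ Sect2.plaqNoBondIn Ω 0 ↔
      (⟨p.src, p.μ⟩ : PBond P 0) ∈ bondsOf (genSet Ω k 0) ∧ (⟨p.src.shift p.μ, p.ν⟩ : PBond P 0) ∈ bondsOf (genSet Ω k 0) ∧
      (⟨p.src.shift p.ν, p.μ⟩ : PBond P 0) ∈ bondsOf (genSet Ω k 0) ∧ (⟨p.src, p.ν⟩ : PBond P 0) ∈ bondsOf (genSet Ω k 0) := by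
  rw [mem_plaqNoBondIn_iff, mem_bondsOf_genSet_zero_iff Ω hk, mem_bondsOf_genSet_zero_iff Ω hk, mem_bondsOf_genSet_zero_iff Ω hk,
    mem_bondsOf_genSet_zero_iff Ω hk]
  have e3 : (⟨p.src.shift p.ν, p.μ⟩ : PBond P 0).tgt = (p.src.shift p.μ).shift p.ν := by
    show (p.src.shift p.ν).shift p.μ = _
    rw [shift_shift_comm]
  simp only [Nat.zero_add, e3]
  exact Iff.rfl

/-- **★ FILE 8 v1.3's LEVEL-0 PRINTED RANGE IS EXACTLY THE SET OF PLAQUETTES WITH ALL FOUR BONDS IN `Λ₀`** (`k ≥ 1`; a plaquette all of whose bonds meet `Γ₀` touches `Γ₀`).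
[cite: Balaban1985Variational, (7) p.278 L23–28; Balaban1985RegularSpaces, (1.5) p.77 (bookkeeping)] -/
theorem mem_printedPlaqs_zero_iff_bonds (Ω : ℕ → Set (Site P 0)) {k : ℕ} (hk : 0 < k) (p : Plaq P 0) :
    p ∈ Sect2.printedPlaqs Ω k 0 ↔
      (⟨p.src, p.μ⟩ : PBond P 0) ∈ bondsOf (genSet Ω k 0) ∧ (⟨p.src.shift p.μ, p.ν⟩ : PBond P 0) ∈ bondsOf (genSet Ω k 0) ∧
      (⟨p.src.shift p.ν, p.μ⟩ : PBond P 0) ∈ bondsOf (genSet Ω k 0) ∧ (⟨p.src, p.ν⟩ : PBond P 0) ∈ bondsOf (genSet Ω k 0) := by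
  constructor
  · intro hp
    exact (mem_plaqNoBondIn_zero_iff_bonds Ω hk p).1 hp.2
  · intro hb
    refine ⟨?_, (mem_plaqNoBondIn_zero_iff_bonds Ω hk p).2 hb⟩
    -- the first bond meets `Γ₀`, so `p` touches `Γ₀`
    rcases hb.1 with h | h
    · exact Or.inl h
    · exact Or.inr (Or.inl h)

/-- **★★ EVERY LEVEL-0 PRINTED PLAQUETTE IS PINNED DATA**: for `k ≥ 1` and every `U₀` in the fibre of `W` on `genSet Ω k`, `U₀(∂p) = W₀(∂p)` on all of
`Sect2.printedPlaqs Ω k 0` — FILE 8 v1.3's level-0 clause constrains data-determined plaquettes only, and all of them (print's first formula, no `V̄`).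
[cite: Balaban1985Variational, (7) p.278 L23–28; Balaban1988Convergent, (2.10)–(2.12) p.256 (bookkeeping)] -/
theorem plaqHol_eq_of_agreeOn_of_mem_printedPlaqs_zero {G : Type*} [GaugeGroup G] (av : ∀ j, Averaging P j G) {Ω : ℕ → Set (Site P 0)} {k : ℕ} (hk : 0 < k)
    {W : MSField P G} {U₀ : GaugeField P 0 G} (h : AgreeOn (genSet Ω k) (avgFamily av U₀) W) {p : Plaq P 0} (hp : p ∈ Sect2.printedPlaqs Ω k 0) :
    GaugeField.plaqHol U₀ p = GaugeField.plaqHol (W 0) p := by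
  obtain ⟨hb1, hb2, hb3, hb4⟩ := (mem_printedPlaqs_zero_iff_bonds Ω hk p).1 hp
  exact plaqHol_eq_of_agreeOn_of_bonds av h p hb1 hb2 hb3 hb4

/-- Consequently the v1.3 level-0 clause, read on any fibre element, IS the clause on the datum. [cite: Balaban1985Variational, (7) p.278 (bookkeeping)] -/
theorem plaqSmallOn_printedPlaqs_zero_iff_of_agreeOn {G : Type*} [GaugeGroup G] (av : ∀ j, Averaging P j G) {Ω : ℕ → Set (Site P 0)} {k : ℕ} (hk : 0 < k)
    {W : MSField P G} {U₀ : GaugeField P 0 G} (h : AgreeOn (genSet Ω k) (avgFamily av U₀) W) (δ : ℝ) :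
    PlaqSmallOn (Sect2.printedPlaqs Ω k 0) δ U₀ ↔ PlaqSmallOn (Sect2.printedPlaqs Ω k 0) δ (W 0) := by
  constructor
  · intro hU p hp
    rw [← plaqHol_eq_of_agreeOn_of_mem_printedPlaqs_zero av hk h hp]
    exact hU p hp
  · intro hW p hp
    rw [plaqHol_eq_of_agreeOn_of_mem_printedPlaqs_zero av hk h hp]
    exact hW p hp

variable {F : T4Family} {N : ℕ} [NeZero N]

/-- **★★ THE C″ CERTIFICATE — the print-faithful Λ-range level-0 clause EXCLUDES the corner witness that `outerPlaqs`∕`plaqInside` admit.**  For every `N ≥ 2`,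
`ν`, `K` and `0 ≤ t ≤ 2` there are: the SEPARATED one-cube index `s` of p498335 (`k = 1`, `Ω₁ = Λ₁ = π([0, L−1]⁴)`), its corner plaquette `p` (three corners in
`Γ₀`, far corner in `Ω₁`; `p ∈ Sect2.printedPlaqs s.Ω 1 0`, `p ∉ Sect2.outerPlaqs s.Ω 1 0`) and a scale-0 datum `W₀` (jump `g`, `dist1 g = t`, on the bond entering
`Ω₁` at the far corner — dag-n07-e 19a's single-bond datum, by name) such that: (i) `W₀(∂p) = g⁻¹`, so EVERY fibre element `U₀` of any multi-scale datum `W`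
with `W 0 = W₀` has `U₀(∂p) = g⁻¹` (pinned, `dist1 = t`); (ii) `W₀` passes FILE 8 v1.2's level-0 clause `PlaqSmallOn (outerPlaqs s.Ω 1 0) δ₀` AND v1.0's `PlaqSmallOn (plaqInside (genSet s.Ω 1 0)) δ₀` for
EVERY `δ₀ > 0` (every plaquette inside `Γ₀` is trivial); (iii) `W₀` FAILS v1.3's printed-range clause `PlaqSmallOn (printedPlaqs s.Ω 1 0) δ₀` for every `δ₀ ≤ t`,
hence EVERY completion `W` of `W₀` at the higher scales fails `Sect2.DataSmall7P av s.Ω 1 δ W` whenever `δ 0 ≤ t`, for every averaging `av`.  (The rest of (M3) —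
thresholds, class, existence of a minimiser by small-action boundary avoidance, `¬ VariationalThm1RegSepMixed` — is dag-n07-e's INTENT-19 and is not restated.)
Repair C″ = FILE 8 v1.3's `VariationalThm1RegSepPrinted` (print's (7) at level 0 on the pinned range; dag-ref-G l.17323, dag-ref-C l.17306, dag-n07-e (C) (r1′)):
the witness misses it.
[cite: Balaban1985Variational, (7) p.278 L23–28, Thm 1 (8) p.279; Balaban1985RegularSpaces, (1.5) p.77; Balaban1988Convergent, (2.2) p.255, (2.10)–(2.12) p.256 (bookkeeping)] -/
theorem cornerDatum_outer_and_not_printed (hN : 2 ≤ N) (ν : Stage7Numerics) (K : ℕ) {t : ℝ} (ht0 : 0 ≤ t) (ht2 : t ≤ 2) :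
    ∃ (s : SeqOfRecord F ν 1 (fun _ => (1 : ℝ)) K 1) (p : Plaq (F.P K) 0) (g : SU N) (W₀ : GaugeField (F.P K) 0 (SU N)),
      Sect2.SeqSeparated ν.M₁ s ∧ dist1 g = t ∧
      p ∈ B8Eq17ClassAkV1.plaqsOf (s.Ω 1) ∧ p.src ∉ s.Ω 1 ∧ p.src.shift p.μ ∉ s.Ω 1 ∧ p.src.shift p.ν ∉ s.Ω 1 ∧ (p.src.shift p.μ).shift p.ν ∈ s.Ω 1 ∧
      p ∈ Sect2.printedPlaqs s.Ω 1 0 ∧ p ∉ Sect2.outerPlaqs s.Ω 1 0 ∧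
      GaugeField.plaqHol W₀ p = g⁻¹ ∧
      (∀ (av : ∀ j, Averaging (F.P K) j (SU N)) (W : MSField (F.P K) (SU N)) (U₀ : GaugeField (F.P K) 0 (SU N)), W 0 = W₀ →
        AgreeOn (genSet s.Ω 1) (avgFamily av U₀) W → GaugeField.plaqHol U₀ p = g⁻¹ ∧ dist1 (GaugeField.plaqHol U₀ p) = t) ∧
      (∀ δ₀ : ℝ, 0 < δ₀ → PlaqSmallOn (Sect2.outerPlaqs s.Ω 1 0) δ₀ W₀) ∧
      (∀ δ₀ : ℝ, 0 < δ₀ → PlaqSmallOn (plaqInside (genSet s.Ω 1 0)) δ₀ W₀) ∧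
      (∀ δ₀ : ℝ, δ₀ ≤ t → ¬ PlaqSmallOn (Sect2.printedPlaqs s.Ω 1 0) δ₀ W₀) ∧
      (∀ (av : ∀ j, Averaging (F.P K) j (SU N)) (δ : ℕ → ℝ) (W : MSField (F.P K) (SU N)), W 0 = W₀ → δ 0 ≤ t →
        ¬ Sect2.DataSmall7P av s.Ω 1 δ W) := by
  obtain ⟨s, hsΩ, hsep⟩ := exists_seq_singleCube F ν K
  obtain ⟨p, hpX, h1, h2, h3⟩ :=
    exists_corner_plaq (P := F.P K) (by rw [T4Family.P_d]; norm_num) F.hL.2.le (lt_sitesPerDir_zero F K)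
  obtain ⟨g, hg⟩ := exists_su_dist1_eq (N := N) hN ht0 ht2
  have hfar : (p.src.shift p.μ).shift p.ν ∈ cubeEnl (F.P K) F.L 0 0 := far_corner_mem_of_plaqsOf hpX h1 h2 h3
  have hfar' : (p.src.shift p.ν).shift p.μ ∈ s.Ω 1 := by rw [← shift_shift_comm, hsΩ]; exact hfar
  -- dag-n07-e 19a's single-bond datum at the bond `⟨x + e_ν, μ⟩` ENTERING `Ω₁` at the far corner
  set W₀ : GaugeField (F.P K) 0 (SU N) := fun b => if b.src = p.src.shift p.ν ∧ b.dir = p.μ then g else 1 with hW₀def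
  have hW₀p : GaugeField.plaqHol W₀ p = g⁻¹ := plaqHol_single_corner p g
  -- the four bonds of `p` belong to `Λ₀ = bondsOf Γ₀`
  have hb := cornerPlaq_bonds_mem_bondsOf one_pos s.Ω p (by rw [hsΩ]; exact h1) (by rw [hsΩ]; exact h2) (by rw [hsΩ]; exact h3)
  obtain ⟨hb1, hb2, hb3, hb4⟩ := hb
  have hΓ : genSet s.Ω 1 0 = (s.Ω 1)ᶜ := genSet_zero_of_pos s.Ω one_pos
  have hin : ∀ δ₀ : ℝ, 0 < δ₀ → PlaqSmallOn (plaqInside (genSet s.Ω 1 0)) δ₀ W₀ := by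
    intro δ₀ hδ q hq
    rw [hΓ] at hq
    rw [plaqHol_single_eq_one_of_plaqInside_compl hfar' g hq, GaugeGroup.dist1_one]
    exact hδ
  have hpP : p ∈ Sect2.printedPlaqs s.Ω 1 0 := (mem_printedPlaqs_zero_iff_bonds s.Ω one_pos p).2 ⟨hb1, hb2, hb3, hb4⟩
  have hpO : p ∉ Sect2.outerPlaqs s.Ω 1 0 := by
    intro hp
    have h4 := ((mem_outerPlaqs_iff s.Ω 1 0 p).1 hp).2.2.2.2
    simp only [Nat.zero_add, pts_zero] at h4
    exact h4 (by rw [hsΩ]; exact hfar)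
  have hnotP : ∀ δ₀ : ℝ, δ₀ ≤ t → ¬ PlaqSmallOn (Sect2.printedPlaqs s.Ω 1 0) δ₀ W₀ := by
    intro δ₀ hδ hsmall
    have h := hsmall p hpP
    rw [hW₀p, GaugeGroup.dist1_inv, hg] at h
    exact absurd h (not_lt.mpr hδ)
  refine ⟨s, p, g, W₀, hsep, hg, by rw [hsΩ]; exact hpX, by rw [hsΩ]; exact h1, by rw [hsΩ]; exact h2, by rw [hsΩ]; exact h3,
    by rw [hsΩ]; exact hfar, hpP, hpO, hW₀p, ?_, ?_, hin, hnotP, ?_⟩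
  · intro av W U₀ hW0 hagree
    have he : GaugeField.plaqHol U₀ p = g⁻¹ := by
      rw [plaqHol_eq_of_agreeOn_of_bonds av hagree p hb1 hb2 hb3 hb4, hW0, hW₀p]
    exact ⟨he, by rw [he, GaugeGroup.dist1_inv, hg]⟩
  · intro δ₀ hδ q hq
    exact hin δ₀ hδ q (outerPlaqs_zero_subset_plaqInside s.Ω one_pos hq)
  · intro av δ W hW0 hδ h7
    have h0 := h7.1
    rw [hW0] at h0
    exact hnotP (δ 0) hδ h0

end LambdaRange

end Summit.QuantumFields.YangMills.Theorems.K0VariationalThm1OuterRange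

end
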